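import Literature.MathematicalPhysics.QuantumLattice.IsingAnisotropicAntiferromagnetLongRangeOrder
import Literature.MathematicalPhysics.QuantumLattice.HardCoreBosonCondensation
import Literature.MathematicalPhysics.QuantumLattice.HeisenbergOrderDLSProofs
import Literature.MathematicalPhysics.QuantumLattice.XXZAntiferromagnetGroundStateOrder
import HarnessLib

/-!
# The hard-core lattice Bose gas with nearest-neighbour repulsion: the XXZ dictionary and the
# checkerboard SOLID at low temperature and strong repulsion (Fröhlich–Lieb 1978, model (3))

Topic `MathematicalPhysics/QuantumLattice`; companion of `HardCoreBosonCondensation.lean` (the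
hopping-only gas = XY model ⇒ Bose–Einstein condensation). Adding a nearest-neighbour repulsion
`V` at the particle–hole symmetric chemical potential,
`H = Σ_⟨xy⟩ [-t(a†_x a_y + a†_y a_x) + V(n_x - ½)(n_y - ½)] = Σ_⟨xy⟩ [-2t(S¹_xS¹_y + S²_xS²_y) + V S³_xS³_y]`
(Matsubara–Matsuda 1956: the lattice gas with hard cores and nearest-neighbour interaction is the
spin-½ XXZ model), and on a bipartite torus the rotation by `π` about the 1-axis on the odd
sublattice (`⊗_{x odd} σˣ_x`) turns it into `V·H_FL(α)`, `α = 2t/V`, where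
`H_FL(α) = -Σ_⟨xy⟩(αS¹S¹ - αS²S² + S³S³) = xyzRealFieldHamiltonian L 1 α (-α) 0` is the rotated real
form of Fröhlich–Lieb's Ising-anisotropic quantum antiferromagnet (model (3)) used by the tree's
`IsingAnisotropicAntiferromagnetLongRangeOrder.lean`. Gibbs states are covariant, so the tree's
volume-uniform two-point bound `Re⟨σₘσₙ⟩_β ≥ ½` (`anisoAF_sigma_twoPoint_ge_half_explicit`,
`σ = 2S³`) becomes, for the Bose gas, STAGGERED density order:

* §1 `bond`, `hamiltonianNN` — the model on `(ℤ/Lℤ)^d`; `bond_eq_spin` — its XXZ form.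
* §2 `sublatticeFlip = ⊗_{x odd} σˣ_x`, `sublatticeFlip_conj_siteSpin` (`S¹ ↦ S¹`, `S²,S³ ↦ ∓` on odd
  sites), `sublatticeFlip_conj_bond` and **`sublatticeFlip_conj_hamiltonianNN`**:
  `W H Wᴴ = V · xyzRealFieldHamiltonian L 1 (2t/V) (-2t/V) 0` (`L` even, `L ≥ 3`).
* §3 **`checkerboardSolid`** — on `(ℤ/2Nℤ)²`, `N` even, `N > 1`: if `0 ≤ 2t/V ≤ (1/66)(2·10³²⁰)⁻³²`
  and `βV ≥ 16(log(2·10³²⁰) + 4 log 2)` then for all sites `m ≠ n`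
  `ε_m ε_n · Re⟨(2n_m - 1)(2n_n - 1)⟩_β ≥ ½`, `ε = +1 / -1` on the even / odd sublattice — the
  occupation pattern is locked to a checkerboard uniformly in the distance and the volume (a
  density-wave SOLID; Fröhlich–Lieb's Néel order of `sgn Sᶻ` read through the dictionary).

* §4 **Zero temperature, `d = 2`** (the tree's certified XXZ windows): the Bose gas is
  `xxzHamiltonian 1 (torusGraph d L) (-2t) (-V/2t)` (`hamiltonianNN_eq_xxzHamiltonian`), so for
  `0 ≤ V ≤ 0.3t` the ground states have long-range PHASE coherence of the field quadrature
  `q = ½(a + a†)` (`superfluid_ground`, from `hardCoreBoson_ground_planar_spinHalf_x`), and for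
  `V ≥ 5t` staggered DENSITY long-range order (`solid_ground`, from `xxzAF_ground_neel_spinHalf`
  through Dyson–Lieb–Simon's axial sublattice rotation, the tree's
  `sublatticeOpZ_conj_anisotropicTorus`; `groundStateXXZCorrTorus_two_neg`): the two competing orders of the lattice Bose gas, each with
  a certified window.

WHAT THIS IS NOT: the constants are Fröhlich–Lieb's method with the tree's honest (astronomically
small) thresholds, not realistic ones; `d = 2` and `T > 0` only (the solid at `T = 0`, other
fillings, and the superfluid–solid transition are not addressed); no Hubbard-model or material
statement. No `sorry`, no named fact; definitions with bodies: `bond`, `hamiltonianNN`,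
`torusParity`, `sublatticeSign`, `sublatticeFlip`, `occSign`, `quadrature`, `groundQuadratureCorr`,
`groundDensityCorr`.

## References

* [MatsubaraMatsuda1956] T. Matsubara, H. Matsuda, Prog. Theor. Phys. 16 (1956) 569–582, §2
  (lattice gas with hard cores and nearest-neighbour interaction ↔ anisotropic spin-½ model).
* [FrohlichLieb1978] J. Fröhlich, E. H. Lieb, *Phase transitions in anisotropic lattice spin
  systems*, Comm. Math. Phys. 60 (1978) 233–267, §I.A model (3), eq. (1.4a) (the rotation), Thm. 1.1,
  Cor. 1.2, Prop. 3.4, §IV (c').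
* [AizenmanEtAl2004] M. Aizenman, E. H. Lieb, R. Seiringer, J. P. Solovej, J. Yngvason, Phys. Rev.
  A 70 (2004) 023612, §II (hard-core bosons as spins ½).
* [DysonLiebSimon1978] F. J. Dyson, E. H. Lieb, B. Simon, J. Stat. Phys. 18 (1978) 335–383, §2 (the
  sublattice rotation between ferro- and antiferromagnet).
* [BjornbergUeltschi2022] J. E. Björnberg, D. Ueltschi, arXiv:2204.12896, Prop. 2.4 (frame changes).
* [KuboKishi1988] K. Kubo, T. Kishi, Phys. Rev. Lett. 61 (1988) 2585; [WischmannMullerhartmann1991]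
  H.-A. Wischmann, E. Müller-Hartmann, J. Phys. I France 1 (1991) 647 (the XXZ windows, as certified in
  the tree's `XXZAntiferromagnetGroundStateOrder.lean`).
-/

noncomputable section

open Matrix Complex Finset
open scoped ComplexOrder

namespace Literature.MathematicalPhysics.QuantumLattice

open SpinOperators Literature.Probability.LatticeModels

namespace HardCoreBoson

variable {Λ : Type*} [Fintype Λ] [DecidableEq Λ]

/-! ## §1 The Bose gas with nearest-neighbour repulsion and its XXZ form -/

/-- The bond term `-t(a†_x a_y + a†_y a_x) + V(n_x - ½)(n_y - ½)` (hopping `t`, repulsion `V`, at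
the particle–hole symmetric chemical potential `μ = zV/2`). [cite: MatsubaraMatsuda1956, §2] -/
def bond (t V : ℝ) (x y : Λ) : Op Λ 2 :=
  -((t : ℂ) • (cre x * ann y + cre y * ann x)) +
    (V : ℂ) • ((num x - (1 / 2 : ℂ) • 1) * (num y - (1 / 2 : ℂ) • 1))

/-- The bond term is symmetric in its two sites. [cite: MatsubaraMatsuda1956, §2] -/
theorem bond_comm (t V : ℝ) (x y : Λ) : bond t V x y = bond t V y x := by
  by_cases hxy : x = y
  · rw [hxy]
  · rw [bond, bond, add_comm (cre x * ann y)]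
    congr 2
    rw [num_eq, num_eq, add_sub_assoc, add_sub_assoc]
    have h := (siteSpin_commute_of_ne_holds 1 hxy 2 2).eq
    simp only [Matrix.add_mul, Matrix.mul_add, Matrix.smul_mul, Matrix.mul_smul, Matrix.sub_mul,
      Matrix.mul_sub, Matrix.one_mul, Matrix.mul_one, h]
    module

/-- **Matsubara–Matsuda (XXZ form)**: `bond = -2t(S¹_xS¹_y + S²_xS²_y) + V S³_xS³_y` for `x ≠ y`.
[cite: MatsubaraMatsuda1956, §2] [cite: AizenmanEtAl2004, §II eq. (2.1)] -/
theorem bond_eq_spin (t V : ℝ) {x y : Λ} (hxy : x ≠ y) :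
    bond t V x y = -((2 * t : ℝ) : ℂ) • (siteSpin 1 x 0 * siteSpin 1 y 0 + siteSpin 1 x 1 * siteSpin 1 y 1) +
      (V : ℂ) • (siteSpin 1 x 2 * siteSpin 1 y 2) := by
  rw [bond, hopping_eq hxy, xyBond, spinBond_eq_mul_of_ne hxy, spinBond_eq_mul_of_ne hxy, num_eq,
    num_eq, add_sub_cancel_right, add_sub_cancel_right, smul_smul]
  push_cast
  module

section Torus

variable {d : ℕ} (L : ℕ) [NeZero L]

/-- The **hard-core Bose gas with nearest-neighbour repulsion** on the torus `(ℤ/Lℤ)^d`: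
`H = Σ_{⟨xy⟩} [-t(a†_x a_y + a†_y a_x) + V(n_x - ½)(n_y - ½)]` (sum over the edges of the torus
graph). [cite: MatsubaraMatsuda1956, §2] -/
def hamiltonianNN (t V : ℝ) : Op (TorusSite d L) 2 :=
  ∑ e ∈ (torusGraph d L).edgeFinset, Sym2.lift ⟨fun x y => bond t V x y, fun x y => bond_comm t V x y⟩ e

/-- The parity `Σᵢ xᵢ mod 2` of a site of the even torus (the sublattice label).
[cite: FrohlichLieb1978, eq. (1.4a)] -/
def torusParity (x : TorusSite d L) : ZMod 2 := ∑ i, (ZMod.cast (x i) : ZMod 2)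

/-- The sublattice sign `ε_x = +1` (even sites) / `-1` (odd sites). [cite: FrohlichLieb1978, eq. (1.4a)] -/
def sublatticeSign (x : TorusSite d L) : ℝ := if torusParity L x = 1 then -1 else 1

/-- The **sublattice rotation** `W = ⊗_{x odd} σˣ_x` (rotation by `π` about the 1-axis on the odd
sublattice: `S¹ ↦ S¹`, `S² ↦ -S²`, `S³ ↦ -S³` there) — Fröhlich–Lieb's rotation (1.4a) turning the
antiferromagnet (3) into the ferromagnetic real form. [cite: FrohlichLieb1978, eq. (1.4a)] -/
def sublatticeFlip : Op (TorusSite d L) 2 :=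
  productOp fun x => if torusParity L x = 1 then spinHalfPauli 0 else 1

/-- The site occupation sign `s_x = 2n_x - 1` (`+1` occupied, `-1` empty).
[cite: MatsubaraMatsuda1956, §2] -/
def occSign (x : TorusSite d L) : Op (TorusSite d L) 2 := (2 : ℂ) • num x - 1

variable {L}

/-! ## §2 The sublattice rotation -/

omit [NeZero L] in
/-- On the even torus the parity is additive. [folklore] -/
private theorem torusParity_add (h2 : 2 ∣ L) (x y : TorusSite d L) :
    torusParity L (x + y) = torusParity L x + torusParity L y := by
  simp only [torusParity, Pi.add_apply, ← Finset.sum_add_distrib]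
  refine Finset.sum_congr rfl fun i _ => ?_
  have h := map_add (ZMod.castHom h2 (ZMod 2)) (x i) (y i)
  simpa using h

omit [NeZero L] in
/-- The unit vectors are odd. [folklore] -/
private theorem torusParity_single (h2 : 2 ∣ L) (i : Fin d) :
    torusParity L (Pi.single i (1 : ZMod L) : TorusSite d L) = 1 := by
  rw [torusParity, Finset.sum_eq_single i (fun j _ hj => by simp [Pi.single_eq_of_ne hj])
    (fun h => absurd (Finset.mem_univ i) h), Pi.single_eq_same]
  have h := map_one (ZMod.castHom h2 (ZMod 2))
  simpa using h

omit [NeZero L] in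
/-- Nearest neighbours have opposite parity (even torus). [cite: FrohlichLieb1978, eq. (1.4a)] -/
theorem torusParity_of_adj (h2 : 2 ∣ L) {x y : TorusSite d L} (h : (torusGraph d L).Adj x y) :
    torusParity L y = torusParity L x + 1 := by
  obtain ⟨-, ⟨i, rfl⟩ | ⟨i, rfl⟩⟩ := (torusGraph_adj_iff x y).mp h
  · rw [torusParity_add h2, torusParity_single h2]
  · rw [torusParity_add h2, torusParity_single h2]
    have : ∀ u : ZMod 2, u = u + 1 + 1 := by decide
    exact this _

omit [Fintype Λ] [DecidableEq Λ] in
/-- `σˣ σˣᴴ = 1`. [folklore] -/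
private theorem pauliX_mul_conjTranspose' : spinHalfPauli 0 * (spinHalfPauli 0)ᴴ = 1 := by
  ext i j
  fin_cases i <;> fin_cases j <;> simp [spinHalfPauli, Matrix.conjTranspose, Matrix.mul_apply]

omit [Fintype Λ] [DecidableEq Λ] in
/-- `σˣᴴ σˣ = 1`. [folklore] -/
private theorem pauliX_conjTranspose_mul' : (spinHalfPauli 0)ᴴ * spinHalfPauli 0 = 1 := by
  ext i j
  fin_cases i <;> fin_cases j <;> simp [spinHalfPauli, Matrix.conjTranspose, Matrix.mul_apply]

omit [NeZero L] in
/-- Every factor of `W` satisfies `u uᴴ = 1`. [folklore] -/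
private theorem flipFactor_mul_conjTranspose (x : TorusSite d L) :
    (if torusParity L x = 1 then spinHalfPauli 0 else (1 : Matrix (Fin 2) (Fin 2) ℂ)) *
      (if torusParity L x = 1 then spinHalfPauli 0 else (1 : Matrix (Fin 2) (Fin 2) ℂ))ᴴ = 1 := by
  split_ifs
  · exact pauliX_mul_conjTranspose'
  · simp

omit [NeZero L] in
/-- Every factor of `W` satisfies `uᴴ u = 1`. [folklore] -/
private theorem flipFactor_conjTranspose_mul (x : TorusSite d L) :
    (if torusParity L x = 1 then spinHalfPauli 0 else (1 : Matrix (Fin 2) (Fin 2) ℂ))ᴴ *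
      (if torusParity L x = 1 then spinHalfPauli 0 else (1 : Matrix (Fin 2) (Fin 2) ℂ)) = 1 := by
  split_ifs
  · exact pauliX_conjTranspose_mul'
  · simp

/-- `W Wᴴ = 1`. [cite: FrohlichLieb1978, eq. (1.4a)] -/
theorem sublatticeFlip_mul_conjTranspose : sublatticeFlip (d := d) L * (sublatticeFlip (d := d) L)ᴴ = 1 :=
  productOp_mul_conjTranspose fun x => flipFactor_mul_conjTranspose x

/-- `Wᴴ W = 1`. [cite: FrohlichLieb1978, eq. (1.4a)] -/
theorem sublatticeFlip_conjTranspose_mul : (sublatticeFlip (d := d) L)ᴴ * sublatticeFlip (d := d) L = 1 :=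
  productOp_conjTranspose_mul fun x => flipFactor_conjTranspose_mul x

omit [Fintype Λ] [DecidableEq Λ] in
/-- `σˣ S¹ σˣ = S¹`, `σˣ S² σˣ = -S²`, `σˣ S³ σˣ = -S³` for spin ½. [cite: FrohlichLieb1978, eq. (1.4a)] -/
private theorem pauliX_conj_spinVec (α : Fin 3) :
    spinHalfPauli 0 * spinVec 1 α * (spinHalfPauli 0)ᴴ =
      (if α = 0 then (1 : ℂ) else -1) • spinVec 1 α := by
  rw [spinVec_one_eq_half_spinHalfPauli]
  fin_cases α <;>
    · ext i j
      fin_cases i <;> fin_cases j <;>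
        norm_num [spinHalfPauli, Matrix.conjTranspose, Matrix.mul_apply, Fin.sum_univ_two]

omit [NeZero L] in
/-- The factor conjugation `u_x Sᵅ u_xᴴ = ε^α_x Sᵅ`. [cite: FrohlichLieb1978, eq. (1.4a)] -/
private theorem flipFactor_conj_spinVec (x : TorusSite d L) (α : Fin 3) :
    (if torusParity L x = 1 then spinHalfPauli 0 else (1 : Matrix (Fin 2) (Fin 2) ℂ)) * spinVec 1 α *
        (if torusParity L x = 1 then spinHalfPauli 0 else (1 : Matrix (Fin 2) (Fin 2) ℂ))ᴴ =
      (if torusParity L x = 1 ∧ α ≠ 0 then (-1 : ℂ) else 1) • spinVec 1 α := by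
  by_cases hx : torusParity L x = 1
  · rw [if_pos hx, pauliX_conj_spinVec]
    by_cases hα : α = 0 <;> simp [hx, hα]
  · rw [if_neg hx, if_neg (fun h => hx h.1)]
    simp

/-- **The rotation acts on spins by sublattice signs**: `W Sᵅ_x Wᴴ = Sᵅ_x` for `α = 1` or `x`
even, `= -Sᵅ_x` for `α = 2, 3` and `x` odd. [cite: FrohlichLieb1978, eq. (1.4a)] -/
theorem sublatticeFlip_conj_siteSpin (x : TorusSite d L) (α : Fin 3) :
    sublatticeFlip (d := d) L * siteSpin 1 x α * (sublatticeFlip (d := d) L)ᴴ =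
      (if torusParity L x = 1 ∧ α ≠ 0 then (-1 : ℂ) else 1) • siteSpin 1 x α := by
  rw [sublatticeFlip, productOp_conj_siteSpin (fun y => flipFactor_mul_conjTranspose y), siteSpin,
    ← onSite_smul', ← flipFactor_conj_spinVec x α]

/-- **The rotated bond**: for nearest neighbours `x, y` of the even torus,
`W [-2t(S¹S¹ + S²S²) + V S³S³]_{xy} Wᴴ = V · τ_{2t/V}(x,y)` with
`τ_α(x,y) = -αS¹_xS¹_y + αS²_xS²_y - S³_xS³_y = xyzRealBond 1 α (-α) 0 x y` (`V ≠ 0`).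
[cite: FrohlichLieb1978, §I.A (3), eq. (1.4a)] -/
theorem sublatticeFlip_conj_bond (h2 : 2 ∣ L) {t V : ℝ} (hV : V ≠ 0) {x y : TorusSite d L}
    (hxy : (torusGraph d L).Adj x y) :
    sublatticeFlip (d := d) L * bond t V x y * (sublatticeFlip (d := d) L)ᴴ =
      (V : ℂ) • xyzRealBond 1 (2 * t / V) (-(2 * t / V)) (fun _ => (0 : ℝ)) x y := by
  have hne : x ≠ y := hxy.ne
  have hpar := torusParity_of_adj h2 hxy
  have hu : ∀ z : TorusSite d L, (if torusParity L z = 1 then spinHalfPauli 0 else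
      (1 : Matrix (Fin 2) (Fin 2) ℂ))ᴴ * (if torusParity L z = 1 then spinHalfPauli 0 else 1) = 1 :=
    fun z => flipFactor_conjTranspose_mul z
  -- the signs on the bond: `ε^α_x ε^α_y = +1` for `α = 1`, `-1` for `α = 2, 3`
  have hsign : ∀ α : Fin 3, (if torusParity L x = 1 ∧ α ≠ 0 then (-1 : ℂ) else 1) *
      (if torusParity L y = 1 ∧ α ≠ 0 then (-1 : ℂ) else 1) = if α = 0 then 1 else -1 := by
    intro α
    rw [hpar]
    have hcases : ∀ u : ZMod 2, (u = 1 ∧ ¬ (u + 1 = 1)) ∨ (¬ u = 1 ∧ u + 1 = 1) := by decide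
    rcases hcases (torusParity L x) with ⟨h1, h2'⟩ | ⟨h1, h2'⟩ <;> by_cases hα : α = 0 <;>
      simp [h1, h2', hα]
  have hconj : ∀ α : Fin 3, sublatticeFlip (d := d) L * (siteSpin 1 x α * siteSpin 1 y α) * (sublatticeFlip (d := d) L)ᴴ
      = (if α = 0 then (1 : ℂ) else -1) • (siteSpin 1 x α * siteSpin 1 y α) := by
    intro α
    rw [sublatticeFlip, productOp_conj_mul hu, ← sublatticeFlip, sublatticeFlip_conj_siteSpin,
      sublatticeFlip_conj_siteSpin, Matrix.smul_mul, Matrix.mul_smul, smul_smul, hsign]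
  rw [bond_eq_spin t V hne, xyzRealBond, spinBond_eq_mul_of_ne hne, spinBond_eq_mul_of_ne hne,
    spinBond_eq_mul_of_ne hne]
  simp only [Matrix.mul_add, Matrix.add_mul, Matrix.mul_smul, Matrix.smul_mul, hconj]
  simp only [Fin.isValue, ↓reduceIte, one_ne_zero, Fin.reduceEq, sub_self, Complex.ofReal_zero,
    zero_smul, sub_zero, zero_pow, Ne, OfNat.ofNat_ne_zero, not_false_eq_true, zero_div, add_zero]
  have h1 : (V : ℂ) * ((2 * t / V : ℝ) : ℂ) = ((2 * t : ℝ) : ℂ) := by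
    push_cast
    field_simp
  have h2' : (V : ℂ) * ((-(2 * t / V) : ℝ) : ℂ) = -((2 * t : ℝ) : ℂ) := by
    push_cast
    field_simp
  simp only [smul_sub, smul_neg, smul_smul, h1, h2']
  module

/-- **The hard-core Bose gas with repulsion is unitarily Fröhlich–Lieb's model (3)**:
`W H Wᴴ = V · xyzRealFieldHamiltonian L 1 (2t/V) (-2t/V) 0` on the even torus (`V ≠ 0`).
[cite: FrohlichLieb1978, §I.A (3), eq. (1.4a)] [cite: MatsubaraMatsuda1956, §2] -/
theorem sublatticeFlip_conj_hamiltonianNN (h2 : 2 ∣ L) {t V : ℝ} (hV : V ≠ 0) :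
    sublatticeFlip (d := d) L * hamiltonianNN L t V * (sublatticeFlip (d := d) L)ᴴ =
      (V : ℂ) • xyzRealFieldHamiltonian L 1 (2 * t / V) (-(2 * t / V)) (fun _ => (0 : ℝ)) := by
  rw [hamiltonianNN, xyzRealFieldHamiltonian, Finset.mul_sum, Finset.sum_mul, Finset.smul_sum]
  refine Finset.sum_congr rfl fun e he => ?_
  induction e using Sym2.ind with
  | h x y =>
    rw [SimpleGraph.mem_edgeFinset, SimpleGraph.mem_edgeSet] at he
    simp only [Sym2.lift_mk]
    exact sublatticeFlip_conj_bond h2 hV he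

/-- The Bose gas Hamiltonian in the form `Wᴴ (V·H_FL) W`. [cite: FrohlichLieb1978, eq. (1.4a)] -/
theorem hamiltonianNN_eq_conj (h2 : 2 ∣ L) {t V : ℝ} (hV : V ≠ 0) :
    hamiltonianNN L t V = (sublatticeFlip (d := d) L)ᴴ *
      ((V : ℂ) • xyzRealFieldHamiltonian L 1 (2 * t / V) (-(2 * t / V)) (fun _ => (0 : ℝ))) *
        sublatticeFlip (d := d) L := by
  rw [← sublatticeFlip_conj_hamiltonianNN h2 hV]
  simp only [← Matrix.mul_assoc, sublatticeFlip_conjTranspose_mul, Matrix.one_mul]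
  rw [Matrix.mul_assoc, sublatticeFlip_conjTranspose_mul, Matrix.mul_one]

/-- The occupation sign is Fröhlich–Lieb's order observable: `2n_x - 1 = 2S³_x = P⁺_x - P⁻_x`
(`σ = sgn S³` for spin ½). [cite: FrohlichLieb1978, eq. (1.12)] -/
theorem occSign_eq (x : TorusSite d L) :
    occSign L x = onSite x (szNonnegProj 1 - szNegProj 1) := by
  rw [occSign, szNonnegProj_sub_szNegProj_one, onSite_smul', num_eq, smul_add, smul_smul]
  have : (onSite x (SpinOperators.spinZ 1) : Op (TorusSite d L) 2) = siteSpin 1 x 2 := rfl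
  rw [this]
  norm_num

/-- `2n_x - 1 = 2S³_x`. [cite: AizenmanEtAl2004, §II] -/
theorem occSign_eq_smul_siteSpin (x : TorusSite d L) : occSign L x = (2 : ℂ) • siteSpin 1 x 2 := by
  rw [occSign, num_eq, smul_add, smul_smul]
  norm_num

/-- **The rotation flips the occupation sign on the odd sublattice**: `W s_x Wᴴ = ε_x s_x`.
[cite: FrohlichLieb1978, eq. (1.4a)] -/
theorem sublatticeFlip_conj_occSign (x : TorusSite d L) :
    sublatticeFlip (d := d) L * occSign L x * (sublatticeFlip (d := d) L)ᴴ = ((sublatticeSign L x : ℝ) : ℂ) • occSign L x := by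
  rw [occSign_eq_smul_siteSpin, Matrix.mul_smul, Matrix.smul_mul, sublatticeFlip_conj_siteSpin,
    sublatticeSign, smul_smul, smul_smul]
  congr 1
  split_ifs with h <;> simp_all

/-! ## §3 The checkerboard solid -/

/-- **Gibbs covariance**: boson thermal expectations are expectations of the rotated observable in
Fröhlich–Lieb's model at inverse temperature `βV`:
`⟨O⟩_{β, H} = ⟨W O Wᴴ⟩_{βV, H_FL(2t/V)}`. [cite: FrohlichLieb1978, eq. (1.4a)] -/
theorem gibbsState_hamiltonianNN_eq (h2 : 2 ∣ L) {t V : ℝ} (hV : V ≠ 0) (β : ℝ)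
    (O : Op (TorusSite d L) 2) :
    gibbsState β (hamiltonianNN L t V) O =
      gibbsState (β * V) (xyzRealFieldHamiltonian L 1 (2 * t / V) (-(2 * t / V)) (fun _ => (0 : ℝ)))
        (sublatticeFlip (d := d) L * O * (sublatticeFlip (d := d) L)ᴴ) := by
  rw [hamiltonianNN_eq_conj h2 hV, Matrix.gibbsState_conjTranspose_mul_mul
    sublatticeFlip_mul_conjTranspose sublatticeFlip_conjTranspose_mul, Matrix.gibbsState_ofReal_smul]

/-- **Checkerboard solid of the hard-core Bose gas with strong nearest-neighbour repulsion**
(`d = 2`, `T > 0`). On the torus `(ℤ/2Nℤ)²` (`N` even, `N > 1`), for hopping `t ≥ 0` and repulsion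
`V > 0` with `2t/V ≤ (1/66)·(2·10³²⁰)⁻³²`, and every inverse temperature with
`βV ≥ 16(log(2·10³²⁰) + 4 log 2)`: for all sites `m ≠ n`,
`ε_m ε_n · Re⟨(2n_m - 1)(2n_n - 1)⟩_β ≥ ½` — the occupations are locked to the checkerboard
pattern (same sublattice: both occupied or both empty with probability `≥ ¾`; opposite
sublattices: one occupied, one empty), uniformly in the distance and the volume. This is
Fröhlich–Lieb's long-range order for model (3) (`anisoAF_sigma_twoPoint_ge_half_explicit` at spin
½, `α = 2t/V`) transported by the sublattice rotation and Gibbs covariance.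
[cite: FrohlichLieb1978, §I.A (3), Thm. 1.1, Cor. 1.2, Prop. 3.4, §IV (c')] [cite: MatsubaraMatsuda1956, §2] -/
theorem checkerboardSolid {N : ℕ} [NeZero N] [NeZero (N * 2)] (hN : Even N) (hN1 : 1 < N)
    {t V : ℝ} (ht : 0 ≤ t) (hV : 0 < V)
    (hα : 2 * t / V ≤ (1 / 66 : ℝ) * (2 * 10 ^ 320) ^ (-(32 : ℝ)))
    {β : ℝ} (hβ : 16 * (Real.log (2 * 10 ^ 320) + 4 * Real.log 2) ≤ β * V)
    {m n : TorusSite 2 (N * 2)} (hmn : m ≠ n) :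
    (1 : ℝ) / 2 ≤ sublatticeSign (N * 2) m * sublatticeSign (N * 2) n *
      (gibbsState β (hamiltonianNN (N * 2) t V) (occSign (N * 2) m * occSign (N * 2) n)).re := by
  have h2 : 2 ∣ N * 2 := dvd_mul_left 2 N
  have hu : ∀ z : TorusSite 2 (N * 2), (if torusParity (N * 2) z = 1 then spinHalfPauli 0 else
      (1 : Matrix (Fin 2) (Fin 2) ℂ))ᴴ * (if torusParity (N * 2) z = 1 then spinHalfPauli 0 else 1) = 1 :=
    fun z => flipFactor_conjTranspose_mul z
  -- rotate the observable
  have hobs : sublatticeFlip (d := 2) (N * 2) * (occSign (N * 2) m * occSign (N * 2) n) * (sublatticeFlip (d := 2) (N * 2))ᴴ =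
      ((sublatticeSign (N * 2) m * sublatticeSign (N * 2) n : ℝ) : ℂ) •
        (onSite m (szNonnegProj 1 - szNegProj 1) * onSite n (szNonnegProj 1 - szNegProj 1)) := by
    rw [sublatticeFlip, productOp_conj_mul hu, ← sublatticeFlip, sublatticeFlip_conj_occSign,
      sublatticeFlip_conj_occSign, Matrix.smul_mul, Matrix.mul_smul, smul_smul, occSign_eq, occSign_eq]
    push_cast
    ring_nf
  rw [gibbsState_hamiltonianNN_eq h2 hV.ne' β, hobs, LinearMap.map_smul, smul_eq_mul,
    Complex.re_ofReal_mul]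
  -- Fröhlich–Lieb's bound in the rotated frame
  have hα0 : 0 ≤ 2 * t / V := by positivity
  have hα' : 2 * t / V ≤ ((1 : ℕ) : ℝ) / (64 + 2 * ((1 : ℕ) : ℝ)) *
      (2 * 10 ^ 320) ^ (-(32 / ((1 : ℕ) : ℝ))) := by
    convert hα using 2 <;> norm_num
  have hβ' : 16 * (Real.log (2 * 10 ^ 320) + 4 * Real.log (((1 : ℕ) : ℝ) + 1)) /
      ((1 : ℕ) : ℝ) ^ 2 ≤ β * V := by
    convert hβ using 1
    norm_num
  have hFL := anisoAF_sigma_twoPoint_ge_half_explicit (N := N) 1 le_rfl hN hN1 hα0 hα' hβ' hmn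
  -- `ε² = 1`
  have hε : ∀ x : TorusSite 2 (N * 2), sublatticeSign (N * 2) x * sublatticeSign (N * 2) x = 1 := by
    intro x; unfold sublatticeSign; split_ifs <;> norm_num
  have hεmn : (sublatticeSign (N * 2) m * sublatticeSign (N * 2) n) *
      (sublatticeSign (N * 2) m * sublatticeSign (N * 2) n) = 1 := by
    rw [mul_mul_mul_comm, hε, hε, one_mul]
  rw [← mul_assoc, hεmn, one_mul]
  exact hFL

/-! ## §4 Zero temperature, `d = 2`: superfluid for weak and solid for strong repulsion
(the tree's certified XXZ windows `xxzAF_ground_neel_spinHalf`, `hardCoreBoson_ground_planar_spinHalf_x`) -/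

/-- **The Bose gas with repulsion is the XXZ model** `xxzHamiltonian 1 (torusGraph d L) (-2t) (-V/2t)`
`= -2t Σ_⟨xy⟩(SˣSˣ + SʸSʸ - (V/2t) SᶻSᶻ)` (ferromagnetic planar part, antiferromagnetic axial part;
`t ≠ 0`). [cite: MatsubaraMatsuda1956, §2] [cite: KLS1988PRL, eq. (1)] -/
theorem hamiltonianNN_eq_xxzHamiltonian {t : ℝ} (ht : t ≠ 0) (V : ℝ) :
    hamiltonianNN L t V = xxzHamiltonian 1 (torusGraph d L) (-(2 * t)) (-(V / (2 * t))) := by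
  rw [hamiltonianNN, xxzHamiltonian, Finset.smul_sum]
  refine Finset.sum_congr rfl fun e he => ?_
  induction e using Sym2.ind with
  | h x y =>
    rw [SimpleGraph.mem_edgeFinset, SimpleGraph.mem_edgeSet] at he
    have hne : x ≠ y := he.ne
    simp only [Sym2.lift_mk]
    have h : ((-(2 * t) : ℝ) : ℂ) * ((-(V / (2 * t)) : ℝ) : ℂ) = (V : ℂ) := by
      push_cast
      field_simp
    rw [bond_eq_spin t V hne, spinBond_eq_mul_of_ne hne, spinBond_eq_mul_of_ne hne,
      spinBond_eq_mul_of_ne hne]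
    simp only [smul_add, smul_smul, h]
    push_cast
    module

omit [NeZero L] in
/-- `xxzHamiltonian` is linear in the overall coupling `J`. [cite: Tasaki2020, §2.4] -/
private theorem xxzHamiltonian_mul_coupling {Λ' : Type*} [Fintype Λ'] [DecidableEq Λ'] (n : ℕ)
    (G : SimpleGraph Λ') [DecidableRel G.Adj] (c J Δ : ℝ) :
    xxzHamiltonian n G (c * J) Δ = (c : ℂ) • xxzHamiltonian n G J Δ := by
  rw [xxzHamiltonian, xxzHamiltonian, smul_smul, Complex.ofReal_mul]

/-- **Same ground states as the unit-hopping model**: the tracial ground-state functional of the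
Bose gas equals that of `xxzHamiltonian 1 (torusGraph d L) (-1) (-V/2t)` (`t > 0`; the Hamiltonians
differ by the positive factor `2t`). [cite: Tasaki2020, §2.1] [cite: MatsubaraMatsuda1956, §2] -/
theorem groundStateFunctional_hamiltonianNN {t : ℝ} (ht : 0 < t) (V : ℝ) :
    (hamiltonianNN L t V).groundStateFunctional =
      (xxzHamiltonian 1 (torusGraph d L) (-1) (-(V / (2 * t)))).groundStateFunctional := by
  rw [hamiltonianNN_eq_xxzHamiltonian ht.ne' V,
    show (-(2 * t) : ℝ) = (2 * t) * (-1) by ring, xxzHamiltonian_mul_coupling,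
    Matrix.groundStateFunctional_smul_of_pos (xxzHamiltonian_isHermitian 1 _ _ _) (by positivity)]

/-! ### The superfluid (weak repulsion) -/

/-- The **field quadrature** `q_x = ½(a†_x + a_x)` (`= S¹_x`), whose two-point function is the
`U(1)`-breaking (off-diagonal) order parameter. [cite: AizenmanEtAl2004, §II] -/
def quadrature (x : Λ) : Op Λ 2 := (1 / 2 : ℂ) • (cre x + ann x)

/-- `q_x = S¹_x`. [cite: AizenmanEtAl2004, §II] -/
theorem quadrature_eq (x : Λ) : quadrature x = siteSpin 1 x 0 := by
  rw [quadrature, cre_eq, ann_eq]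
  module

/-- The ground-state quadrature correlation `Re ω(q_x q_y)` of the Bose gas with repulsion on
`(ℤ/Lℤ)^d` (`0` for `L = 0`). [cite: AizenmanEtAl2004, §II eq. (2.2)] -/
def groundQuadratureCorr (L : ℕ) (t V : ℝ) (x y : TorusSite d L) : ℝ :=
  if hL : L = 0 then 0
  else
    haveI : NeZero L := ⟨hL⟩
    ((hamiltonianNN L t V).groundStateFunctional (quadrature x * quadrature y)).re

omit [NeZero L] in
/-- Dictionary: the quadrature correlation is the `x–x` correlation of the XXZ model
`xxzHamiltonian 1 (torusGraph d L) (-1) (-V/2t)`. [cite: MatsubaraMatsuda1956, §2] -/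
theorem groundQuadratureCorr_eq {t : ℝ} (ht : 0 < t) (V : ℝ) (x y : TorusSite d L) :
    groundQuadratureCorr L t V x y = groundStateXXZCorrTorus 0 L 1 (-1) (-(V / (2 * t))) x y := by
  rcases Nat.eq_zero_or_pos L with rfl | hL
  · simp [groundQuadratureCorr]
  · haveI : NeZero L := ⟨hL.ne'⟩
    simp only [groundQuadratureCorr, NeZero.ne L, ↓reduceDIte, groundStateXXZCorrTorus_of_neZero,
      quadrature_eq, groundStateFunctional_hamiltonianNN ht]

/-- **Superfluid ground state of the two-dimensional hard-core Bose gas with weak repulsion**: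
for `t > 0` and `0 ≤ V ≤ 0.3 t` the ground states on the even tori `(ℤ/2kℤ)²` have long-range phase
coherence, `liminf_k |Λ_k|⁻² Σ_{x,y} Re⟨q_x q_y⟩ > 0` (`q = ½(a + a†)`) — the tree's certified
planar window `hardCoreBoson_ground_planar_spinHalf_x` (`-0.15 ≤ Δ ≤ 0`, here `Δ = -V/2t`) read
through the dictionary; `V = 0` is Kennedy–Lieb–Shastry's hard-core Bose gas.
[cite: KLS1988PRL, Theorem] [cite: KuboKishi1988] -/
theorem superfluid_ground {t V : ℝ} (ht : 0 < t) (hV0 : 0 ≤ V) (hV : V ≤ 0.3 * t) :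
    HasEvenTorusLRO (fun L (x y : TorusSite 2 L) => groundQuadratureCorr L t V x y) := by
  have h : (fun L (x y : TorusSite 2 L) => groundQuadratureCorr L t V x y) =
      fun L x y => groundStateXXZCorrTorus 0 (d := 2) L 1 (-1) (-(V / (2 * t))) x y := by
    funext L x y
    exact groundQuadratureCorr_eq ht V x y
  rw [h]
  have h1 : -0.15 ≤ -(V / (2 * t)) := by
    rw [neg_le_neg_iff, div_le_iff₀ (by positivity)]
    norm_num at hV ⊢
    linarith
  have h2 : -(V / (2 * t)) ≤ 0 := by
    rw [neg_nonpos]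
    positivity
  exact hardCoreBoson_ground_planar_spinHalf_x _ h1 h2

/-! ### The solid (strong repulsion) -/

/-- The ground-state density–density correlation `Re ω((n_x - ½)(n_y - ½))` of the Bose gas with
repulsion on `(ℤ/Lℤ)^d` (`0` for `L = 0`). [cite: MatsubaraMatsuda1956, §2] -/
def groundDensityCorr (L : ℕ) (t V : ℝ) (x y : TorusSite d L) : ℝ :=
  if hL : L = 0 then 0
  else
    haveI : NeZero L := ⟨hL⟩
    ((hamiltonianNN L t V).groundStateFunctional
      ((num x - (1 / 2 : ℂ) • 1) * (num y - (1 / 2 : ℂ) • 1))).re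

omit [NeZero L] in
/-- Dictionary: the density–density correlation is the `z–z` correlation of
`xxzHamiltonian 1 (torusGraph d L) (-1) (-V/2t)` (`n_x - ½ = S³_x`). [cite: MatsubaraMatsuda1956, §2] -/
theorem groundDensityCorr_eq {t : ℝ} (ht : 0 < t) (V : ℝ) (x y : TorusSite d L) :
    groundDensityCorr L t V x y = groundStateXXZCorrTorus 2 L 1 (-1) (-(V / (2 * t))) x y := by
  rcases Nat.eq_zero_or_pos L with rfl | hL
  · simp [groundDensityCorr]
  · haveI : NeZero L := ⟨hL.ne'⟩
    have hn : ∀ z : TorusSite d L, num z - (1 / 2 : ℂ) • (1 : Op (TorusSite d L) 2) = siteSpin 1 z 2 :=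
      fun z => by rw [num_eq, add_sub_cancel_right]
    simp only [groundDensityCorr, NeZero.ne L, ↓reduceDIte, groundStateXXZCorrTorus_of_neZero, hn,
      groundStateFunctional_hamiltonianNN ht]

/-- **Axial correlations do not see the planar sign** (Dyson–Lieb–Simon's sublattice rotation
about the 3-axis): on the even torus the `z–z` ground-state correlations of `H_XXZ(-1, -Δ)`
(ferromagnetic planar part) and of the antiferromagnet `H_XXZ(1, Δ)` coincide — the half-turn about
the 3-axis on the odd sublattice (`sublatticeOpZ_conj_anisotropicTorus`, `exists_halfTurn_z`)
conjugates B–U's `H(1,1,-Δ)` into `H(-1,-1,-Δ)` and fixes `S³`. [cite: DysonLiebSimon1978, §2]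
[cite: BjornbergUeltschi2022, Prop. 2.4] -/
theorem groundStateXXZCorrTorus_two_neg (k : ℕ) [NeZero (2 * k)] (Δ : ℝ) (x y : TorusSite d (2 * k)) :
    groundStateXXZCorrTorus 2 (2 * k) 1 (-1) (-Δ) x y = groundStateXXZCorrTorus 2 (2 * k) 1 1 Δ x y := by
  obtain ⟨t, hta, htb, htx, hty, htz⟩ := exists_halfTurn_z 1
  set u : TorusSite d (2 * k) → Matrix (Fin 2) (Fin 2) ℂ := fun z =>
    if (∑ j, ZMod.castHom (dvd_mul_right 2 k) (ZMod 2) (z j)) = 0 then (1 : Matrix _ _ ℂ) else t with hu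
  have hua : ∀ z, u z * (u z)ᴴ = 1 := by
    intro z; simp only [hu]; split_ifs
    · rw [conjTranspose_one, Matrix.mul_one]
    · exact hta
  have hub : ∀ z, (u z)ᴴ * u z = 1 := by
    intro z; simp only [hu]; split_ifs
    · rw [conjTranspose_one, Matrix.mul_one]
    · exact htb
  have hUU : productOp u * (productOp u)ᴴ = 1 := productOp_mul_conjTranspose hua
  have hU'U : (productOp u)ᴴ * productOp u = 1 := productOp_conjTranspose_mul hub
  have hconj : productOp u * anisotropicTorus d (2 * k) 1 1 1 (-Δ) * (productOp u)ᴴ =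
      anisotropicTorus d (2 * k) 1 (-1) (-1) (-Δ) :=
    sublatticeOpZ_conj_anisotropicTorus k hta htb htx hty htz 1 1 (-Δ)
  have hz : ∀ z : TorusSite d (2 * k), productOp u * siteSpin 1 z 2 * (productOp u)ᴴ = siteSpin 1 z 2 := by
    intro z
    rw [productOp_conj_siteSpin hua, siteSpin]
    congr 1
    simp only [hu, spinVec_two]
    split_ifs
    · rw [conjTranspose_one, Matrix.mul_one, Matrix.one_mul]
    · exact htz
  have hO : productOp u * (siteSpin 1 x 2 * siteSpin 1 y 2) * (productOp u)ᴴ =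
      siteSpin 1 x 2 * siteSpin 1 y 2 := by
    rw [productOp_conj_mul hub, hz, hz]
  rw [groundStateXXZCorrTorus_of_neZero, groundStateXXZCorrTorus_of_neZero,
    groundStateFunctional_xxzHamiltonian_torus, groundStateFunctional_xxzHamiltonian_torus,
    show -((-1 : ℝ) * -Δ) = -Δ by ring, show -((1 : ℝ) * Δ) = -Δ by ring, neg_neg, ← hconj]
  conv_rhs => rw [← hO]
  rw [Matrix.groundStateFunctional_unitary_conj hUU hU'U]

/-- **Solid ground state of the two-dimensional hard-core Bose gas with strong repulsion**: for
`t > 0` and `V ≥ 5t` the ground states on the even tori `(ℤ/2kℤ)²` have staggered (checkerboard)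
density long-range order, `liminf_k |Λ_k|⁻² Σ_{x,y} (-1)^x(-1)^y Re⟨(n_x - ½)(n_y - ½)⟩ > 0` — the
tree's certified Ising window of the spin-½ XXZ antiferromagnet (`xxzAF_ground_neel_spinHalf`,
`Δ = V/2t ≥ 5/2`) read through the Matsubara–Matsuda dictionary and Dyson–Lieb–Simon's rotation.
[cite: KuboKishi1988] [cite: WischmannMullerhartmann1991, Abstract] [cite: MatsubaraMatsuda1956, §2] -/
theorem solid_ground {t V : ℝ} (ht : 0 < t) (hV : 5 * t ≤ V) :
    HasStaggeredEvenTorusLRO (fun L (x y : TorusSite 2 L) => groundDensityCorr L t V x y) := by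
  have hΔ : 5 / 2 ≤ V / (2 * t) := by
    rw [le_div_iff₀ (by positivity)]
    linarith
  have h := xxzAF_ground_neel_spinHalf 1 one_pos (V / (2 * t)) hΔ
  -- the two kernels agree on every even torus of positive side
  have hpt : ∀ k : ℕ, 1 ≤ k → ∀ x y : TorusSite 2 (2 * k),
      groundDensityCorr (2 * k) t V x y = groundStateXXZCorrTorus 2 (2 * k) 1 1 (V / (2 * t)) x y := by
    intro k hk x y
    haveI : NeZero (2 * k) := ⟨by omega⟩
    rw [groundDensityCorr_eq ht, groundStateXXZCorrTorus_two_neg]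
  have hev : ∀ᶠ k : ℕ in Filter.atTop,
      (∑ x ∈ halfOpenBox 2 (2 * k), ∑ y ∈ halfOpenBox 2 (2 * k), latticeStagger x * latticeStagger y *
          torusPullback (fun L (x y : TorusSite 2 L) => groundStateXXZCorrTorus 2 L 1 1 (V / (2 * t)) x y)
            (2 * k) x y) / ((halfOpenBox 2 (2 * k)).card : ℝ) ^ 2 =
      (∑ x ∈ halfOpenBox 2 (2 * k), ∑ y ∈ halfOpenBox 2 (2 * k), latticeStagger x * latticeStagger y *
          torusPullback (fun L (x y : TorusSite 2 L) => groundDensityCorr L t V x y) (2 * k) x y) /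
        ((halfOpenBox 2 (2 * k)).card : ℝ) ^ 2 := by
    filter_upwards [Filter.eventually_ge_atTop 1] with k hk
    simp only [torusPullback_apply, hpt k hk]
  unfold HasStaggeredEvenTorusLRO HasStaggeredLongRangeOrder HasLongRangeOrder at h ⊢
  beta_reduce at h ⊢
  rw [Filter.liminf_congr hev] at h
  exact h

end Torus

end HardCoreBoson

end Literature.MathematicalPhysics.QuantumLattice
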